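import Summits.RiemannHypothesis.RiemannHypothesis.Theorems.PfPersistenceF3SharpLocalTwin

/-!
# F3 — FE-honest twins `ζ·(1 + b p^{-s} + p^{1-2s})` — part 3/6: THEOREM F3-A (kernel) — pub-rhpf fake-3

HONEST FRAMING: mechanism/rigidity campaign; no RH claims.  Split of the single staged module `HOME/lean/PFPersistence/F3SharpLocal.lean` v3 (sha16 1e7c8001eda6007d,
1050 lines, `lean check` rc 0 / 0 sorries) into five ≤ 400-line modules for the gate's line lint (REFEREE r10-b):
`…F3SharpLocalDatum` (datum, SHAPE-TWIN identity, the three statements) → `…F3SharpLocalTwin` (generic twin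
lemmas) → `…F3SharpLocalBound` (THEOREM F3-A) → `…F3SharpLocalTemperedAux` (Newton sums, prime-term difference,
PSD autocorrelation, Fejér) → `…F3SharpLocalTempered` (TEMPERED TRANSFER).  Every `def`/`theorem` statement and
proof is verbatim from v3 (v2 3b05073fba483e09 = ADJ A25 add.3 for F3-A); only headers/imports are per-file.
This part: the single visible `P`-mass of `F_{p,b}` at `log p`, the conductor decomposition, and the proofs of
`sharpLocalRayleighBound : SharpLocalRayleighBound` and `sharpLocalNegativeOrZetaNotPositive` (ADJ A25 add.3).
-/

set_option linter.dupNamespace false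

noncomputable section

open MeasureTheory Set Filter Complex
open scoped Real Topology

namespace Summit.RiemannHypothesis.RiemannHypothesis.Theorems.PfPersistenceBarrier

open Literature.NumberTheory.LFunctions ExplicitDatum

namespace F3A

open scoped ComplexConjugate

variable {g : ℝ → ℂ} {b c : ℝ}

/-! ### The prime term of `F_{p,b}` differs from `ζ`'s by the single visible mass at `log p` -/

/-- The prime term of a datum with positions `log n`, as a finite sum when the kernel vanishes for
`|u| > R`. [folklore] -/
theorem primeTerm_eq_sum_of_pos_log {F : ExplicitDatum} (hF : ∀ n, F.pos n = Real.log n)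
    {f : ℝ → ℂ} {R : ℝ} (hf : ∀ u : ℝ, R < |u| → f u = 0) :
    F.primeTerm f = ∑ n ∈ Finset.range ⌈Real.exp (R + 1)⌉₊,
      F.wt n * (f (Real.log n) + f (-Real.log n)) := by
  unfold ExplicitDatum.primeTerm
  simp only [hF]
  refine tsum_eq_sum fun n hn ↦ ?_
  rw [Finset.mem_range, not_lt] at hn
  have hn' : Real.exp (R + 1) ≤ n := (Nat.le_ceil _).trans (by exact_mod_cast hn)
  have hpos : (0 : ℝ) < n := (Real.exp_pos _).trans_le hn'
  have hlog : R + 1 ≤ Real.log n := by rwa [Real.le_log_iff_exp_le hpos]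
  have h1 : R < |Real.log n| := lt_of_lt_of_le (by linarith) (le_abs_self _)
  rw [hf _ h1, hf _ (by rwa [abs_neg]), add_zero, mul_zero]

/-- The `P`-mass at `p` itself: `-s₁ log p/√p = b log p/√p`. [folklore] -/
theorem sharpLocalMass_self {p : ℕ} (hp : p.Prime) (b : ℝ) :
    sharpLocalMass p b p = b * Real.log p / Real.sqrt p := by
  have hlog : Nat.log p p = 1 := by simpa using Nat.log_pow hp.one_lt 1
  unfold sharpLocalMass
  rw [if_pos ⟨hp.two_le, by rw [hlog, pow_one]⟩, hlog]
  simp [newtonSum]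

/-- Trichotomy for the `P`-masses: zero, or at `p`, or at a position `≥ 2 log p`. [folklore] -/
theorem sharpLocalMass_cases {p : ℕ} (hp : p.Prime) (b : ℝ) (n : ℕ) :
    sharpLocalMass p b n = 0 ∨ n = p ∨ 2 * Real.log p ≤ Real.log n := by
  unfold sharpLocalMass
  by_cases h : 2 ≤ n ∧ p ^ Nat.log p n = n
  · right
    obtain ⟨h2, hpow⟩ := h
    rcases hk : Nat.log p n with _ | _ | k
    · rw [hk, pow_zero] at hpow; omega
    · rw [hk, pow_one] at hpow; exact Or.inl hpow.symm
    · right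
      rw [hk] at hpow
      have hn : (n : ℝ) = (p : ℝ) ^ (k + 2) := by exact_mod_cast hpow.symm
      rw [hn, Real.log_pow]
      have hlp : 0 < Real.log p := Real.log_pos (by exact_mod_cast hp.one_lt)
      push_cast
      nlinarith [hlp, Nat.cast_nonneg (α := ℝ) k]
  · left
    rw [if_neg h]

/-- If `f` vanishes for `|u| > R` with `R < 2 log p`, the prime term of `F_{p,b}` minus `ζ`'s is the
single term `(b log p / √p)(f(log p) + f(-log p))`. [folklore] -/
theorem sharpLocal_primeTerm_sub {p : ℕ} (hp : p.Prime) (b : ℝ) {f : ℝ → ℂ} {R : ℝ}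
    (hf : ∀ u : ℝ, R < |u| → f u = 0) (hR : R < 2 * Real.log p) :
    (sharpLocalDatum p b).primeTerm f - zetaDatum.primeTerm f =
      ((b * Real.log p / Real.sqrt p : ℝ) : ℂ) * (f (Real.log p) + f (-Real.log p)) := by
  have hp1 : (1 : ℝ) < p := by exact_mod_cast hp.one_lt
  have hp0 : (0 : ℝ) < p := by linarith
  have hvan : ∀ n : ℕ, R < Real.log n → f (Real.log n) + f (-Real.log n) = 0 := by
    intro n hn
    have h1 : R < |Real.log n| := lt_of_lt_of_le hn (le_abs_self _)
    rw [hf _ h1, hf _ (by rwa [abs_neg]), add_zero]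
  rw [primeTerm_eq_sum_of_pos_log (F := sharpLocalDatum p b) (fun _ ↦ rfl) hf,
    primeTerm_eq_sum_of_pos_log (F := zetaDatum) (fun _ ↦ rfl) hf, ← Finset.sum_sub_distrib]
  have hterm : ∀ n : ℕ, (sharpLocalDatum p b).wt n * (f (Real.log n) + f (-Real.log n)) -
      zetaDatum.wt n * (f (Real.log n) + f (-Real.log n)) =
      ((sharpLocalMass p b n : ℝ) : ℂ) * (f (Real.log n) + f (-Real.log n)) := by
    intro n
    show (zetaDatum.wt n + ((sharpLocalMass p b n : ℝ) : ℂ)) * _ - _ = _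
    ring
  simp only [hterm]
  rw [Finset.sum_eq_single p]
  · rw [sharpLocalMass_self hp]
  · intro n _ hnp
    rcases sharpLocalMass_cases hp b n with h | h | h
    · rw [h]; simp
    · exact absurd h hnp
    · rw [hvan n (lt_of_lt_of_le hR h), mul_zero]
  · intro hnot
    rw [Finset.mem_range, not_lt] at hnot
    have hn' : Real.exp (R + 1) ≤ p := (Nat.le_ceil _).trans (by exact_mod_cast hnot)
    have hlog : R + 1 ≤ Real.log p := by rwa [Real.le_log_iff_exp_le hp0]
    rw [hvan p (by linarith), mul_zero]

/-- `Q_F(g) = Q_ζ(g) + 2 log p·A_g(0) − (prime term of F − prime term of ζ)(A_g)`. [folklore] -/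
theorem sharpLocal_quadratic_decomp (p : ℕ) (b : ℝ) (g : ℝ → ℂ) :
    (sharpLocalDatum p b).quadratic g =
      weilQuadratic g + 2 * Real.log p * weilConv g (weilReflect g) 0 -
        ((sharpLocalDatum p b).primeTerm (weilConv g (weilReflect g)) -
          zetaDatum.primeTerm (weilConv g (weilReflect g))) := by
  rw [← zetaDatum_quadratic]
  unfold ExplicitDatum.quadratic ExplicitDatum.functional
  show zetaDatum.smooth _ + 2 * Real.log p * _ - _ = zetaDatum.smooth _ - _ + _ - _
  ring

/-- The F3-A test function is the twin with `σ = -sign b`. [folklore] -/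
theorem sharpTwinTest_eq_twin (p : ℕ) (b : ℝ) (g₁ : ℝ → ℂ) :
    sharpTwinTest p b g₁ = twin (Real.log p / 2) (-(SignType.sign b : ℝ)) g₁ := by
  funext x
  simp only [sharpTwinTest, twin, translate, sub_neg_eq_add]
  push_cast
  ring

end F3A

open F3A in
/-- **THEOREM F3-A (quantitative form), kernel-checked** (RULING A25(a) target). [folklore] -/
theorem sharpLocalRayleighBound : SharpLocalRayleighBound := by
  intro p hp b w ε hbp hw hw2 hW g₁ hg hs hq
  rw [sharpTwinTest_eq_twin]
  have hp1 : (1 : ℝ) < p := by exact_mod_cast hp.one_lt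
  have hlogp : 0 < Real.log p := Real.log_pos hp1
  have hsqrt : 0 < Real.sqrt p := Real.sqrt_pos.2 (by linarith)
  obtain ⟨c, hc_def⟩ : ∃ c : ℝ, c = Real.log p / 2 := ⟨_, rfl⟩
  obtain ⟨s, hs_def⟩ : ∃ s : ℝ, s = (SignType.sign b : ℝ) := ⟨_, rfl⟩
  obtain ⟨N, hN_def⟩ : ∃ N : ℝ, N = ∫ x, ‖g₁ x‖ ^ 2 := ⟨_, rfl⟩
  rw [← hc_def, ← hs_def]
  rw [← hN_def] at hq ⊢
  have hc0 : 0 < c := by rw [hc_def]; linarith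
  have hwc : w < c := by rw [hc_def]; linarith
  have hc2 : 2 * c = Real.log p := by rw [hc_def]; ring
  have hwin : Real.log p / 2 + w = c + w := by rw [hc_def]
  rw [hwin, zetaDatum_positivityOn_iff] at hW
  -- sign bookkeeping: b ≠ 0, s = sign b ∈ {±1}, b s = |b|, σ := -s
  have hb0 : b ≠ 0 := by
    intro h; rw [h, abs_zero] at hbp; linarith [Real.sqrt_nonneg (p : ℝ)]
  have hsgn : s ^ 2 = 1 ∧ b * s = |b| := by
    rcases lt_or_gt_of_ne hb0 with h | h
    · rw [hs_def, sign_neg h, abs_of_neg h]; simp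
    · rw [hs_def, sign_pos h, abs_of_pos h]; simp
  set σ : ℝ := -s with hσ_def
  have hσ2 : σ ^ 2 = 1 := by rw [hσ_def, neg_sq, hsgn.1]
  -- the two shifted copies
  set u : ℝ → ℂ := F3A.translate (-c) g₁ with hu_def
  set v : ℝ → ℂ := F3A.translate c g₁ with hv_def
  have hu : IsWeilTest u := PfPersistenceF5TailTwins.isWeilTest_translate hg _
  have hv : IsWeilTest v := PfPersistenceF5TailTwins.isWeilTest_translate hg _
  have hus : tsupport u ⊆ Icc (-(c + w)) (c + w) :=
    (PfPersistenceF5TailTwins.tsupport_translate_subset hs (-c)).trans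
      (Icc_subset_Icc (by linarith) (by linarith))
  have hvs : tsupport v ⊆ Icc (-(c + w)) (c + w) :=
    (PfPersistenceF5TailTwins.tsupport_translate_subset hs c).trans
      (Icc_subset_Icc (by linarith) (by linarith))
  have hQu : (weilQuadratic u).re = (weilQuadratic g₁).re := by
    rw [hu_def, PfPersistenceF5TailTwins.weilQuadratic_translate]
  have hQv : (weilQuadratic v).re = (weilQuadratic g₁).re := by
    rw [hv_def, PfPersistenceF5TailTwins.weilQuadratic_translate]
  -- positivity inputs from `hW`
  have hQ1 : 0 ≤ (weilQuadratic g₁).re :=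
    hW g₁ hg (hs.trans (Icc_subset_Icc (by linarith) (by linarith)))
  have hplus : 0 ≤ (weilQuadratic (u + fun x ↦ ((σ : ℝ) : ℂ) * v x)).re :=
    hW _ (hu.add (hv.const_mul _)) (tsupport_add_mul_subset isClosed_Icc hus hvs _)
  -- parallelogram: Re Q(u - σ v) ≤ 2 Re Q(u) + 2 σ² Re Q(v) = 4 Re Q(g₁) ≤ 4 ε N
  have htw : twin c σ g₁ = u + fun x ↦ ((-σ : ℝ) : ℂ) * v x := twin_eq_add c σ g₁
  have hpar1 := ConnesVanSuijlekom.re_weilQuadratic_add_real_mul hu hv (-σ)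
  have hpar2 := ConnesVanSuijlekom.re_weilQuadratic_add_real_mul hu hv σ
  have hQg : (weilQuadratic (twin c σ g₁)).re ≤ 4 * (ε * N) := by
    rw [htw, hpar1, neg_sq, hσ2]
    rw [hpar2, hσ2] at hplus
    rw [hQu, hQv] at hplus ⊢
    linarith [hQ1, hq, hplus]
  -- the autocorrelation of the twin: support, values at 0 and ± log p
  have htwt : IsWeilTest (twin c σ g₁) := isWeilTest_twin hg c σ
  have htws : tsupport (twin c σ g₁) ⊆ Icc (-(c + w)) (c + w) := tsupport_twin_subset hs hc0.le σ
  have hAs : tsupport (weilConv (twin c σ g₁) (weilReflect (twin c σ g₁))) ⊆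
      Icc (-(2 * (c + w))) (2 * (c + w)) :=
    tsupport_weilConv_weilReflect_subset htwt.2 htws
  have hAz : ∀ x : ℝ, 2 * (c + w) < |x| →
      weilConv (twin c σ g₁) (weilReflect (twin c σ g₁)) x = 0 := by
    intro x hx
    refine eq_zero_of_tsupport_subset hAs ?_
    intro hmem
    simp only [mem_Icc] at hmem
    have : |x| ≤ 2 * (c + w) := abs_le.2 ⟨by linarith, by linarith⟩
    linarith
  have hA0 : weilConv (twin c σ g₁) (weilReflect (twin c σ g₁)) 0 = (((1 + σ ^ 2) * N : ℝ) : ℂ) := by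
    rw [hN_def]; exact weilConv_weilReflect_twin_zero hg hs hw hwc σ
  have hA1 : weilConv (twin c σ g₁) (weilReflect (twin c σ g₁)) (Real.log p) =
      -(σ : ℂ) * (N : ℂ) := by
    rw [← hc2, hN_def]; exact weilConv_weilReflect_twin_two_mul hs hw hwc σ
  have hA2 : weilConv (twin c σ g₁) (weilReflect (twin c σ g₁)) (-Real.log p) =
      -(σ : ℂ) * (N : ℂ) := by
    rw [← hc2, hN_def]; exact weilConv_weilReflect_twin_neg_two_mul hs hw hwc σ
  -- the decomposition of Q_F at the twin
  have hR : 2 * (c + w) < 2 * Real.log p := by linarith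
  have hF : ((sharpLocalDatum p b).quadratic (twin c σ g₁)).re =
      (weilQuadratic (twin c σ g₁)).re + 2 * Real.log p * ((1 + σ ^ 2) * N)
        - 2 * (b * (-σ)) * (Real.log p / Real.sqrt p) * N := by
    rw [sharpLocal_quadratic_decomp, sharpLocal_primeTerm_sub hp b hAz hR, hA0, hA1, hA2]
    have e1 : (2 * (Real.log p : ℂ) * (((1 + σ ^ 2) * N : ℝ) : ℂ)) =
        ((2 * Real.log p * ((1 + σ ^ 2) * N) : ℝ) : ℂ) := by push_cast; ring
    have e2 : ((b * Real.log p / Real.sqrt p : ℝ) : ℂ) * (-(σ : ℂ) * (N : ℂ) + -(σ : ℂ) * (N : ℂ)) =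
        ((2 * (b * (-σ)) * (Real.log p / Real.sqrt p) * N : ℝ) : ℂ) := by push_cast; ring
    rw [e1, e2, Complex.sub_re, Complex.add_re, Complex.ofReal_re, Complex.ofReal_re]
  rw [hF, hσ2]
  have hbσ : b * (-σ) = |b| := by rw [hσ_def, neg_neg]; exact hsgn.2
  rw [hbσ]
  have hN0 : 0 ≤ N := by rw [hN_def]; exact integral_nonneg fun t ↦ by positivity
  have e3 : (2 * ε - (|b| / Real.sqrt p - 2) * Real.log p) * (2 * N) =
      4 * (ε * N) + 2 * Real.log p * ((1 + 1) * N) - 2 * |b| * (Real.log p / Real.sqrt p) * N := by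
    ring
  rw [e3]
  linarith [hQg]

/-- **THEOREM F3-A (dichotomy form), kernel-checked.** [folklore] -/
theorem sharpLocalNegativeOrZetaNotPositive : SharpLocalNegativeOrZetaNotPositive :=
  sharpLocalNegativeOrZetaNotPositive_of_bound sharpLocalRayleighBound

end Summit.RiemannHypothesis.RiemannHypothesis.Theorems.PfPersistenceBarrier
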